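import Summits.BirchSwinnertonDyer.BirchSwinnertonDyer.Theorems.ByReductionTypeAtTwoFineSelmerConjAAtTwoAdditivePotGoodChevalleyStampsB
import Summits.BirchSwinnertonDyer.BirchSwinnertonDyer.Theorems.ByReductionTypeAtTwoFineSelmerConjAAtTwoAdditivePotGoodChevalleyStampsC
import Summits.BirchSwinnertonDyer.BirchSwinnertonDyer.Theorems.ByReductionTypeAtTwoFineSelmerConjAAtTwoAdditivePotGoodClassNumberOned11988n
import Summits.BirchSwinnertonDyer.BirchSwinnertonDyer.Theorems.ByReductionTypeAtTwoFineSelmerConjAAtTwoAdditivePotGoodClassNumberOned12936n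
import Summits.BirchSwinnertonDyer.BirchSwinnertonDyer.Theorems.ByReductionTypeAtTwoFineSelmerConjAAtTwoAdditivePotGoodClassNumberOned6756n
import Summits.BirchSwinnertonDyer.BirchSwinnertonDyer.Theorems.ByReductionTypeAtTwoFineSelmerConjAAtTwoAdditivePotGoodTwoLayerStampsEvenIndexC
import Summits.BirchSwinnertonDyer.BirchSwinnertonDyer.Theorems.ByReductionTypeAtTwoFineSelmerConjAAtTwoAdditivePotGoodTwoLayerStampsEvenIndexD
import HarnessLib

/-!
# Route `ByReductionTypeAtTwo` (rung K4), crux C1″ `FineSelmerConjAAtTwoAdditivePotGood` (item stmt-BirchSwinnertonDyer-22615):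
# IWASAWA `μ₂ = 0`, KERNEL, BY NAME, for the cubic point fields of the census rows with TWO primes above `2` or EVEN class number
# and `Δ_cubic < 0` — part B (Chevalley no-bit rows, class-number-certificate stamps) (a `--supports 22615` file; seat `bsd-2adic-k4-w1` GEN 8, lane (c) «capitulation/Chevalley rows» of pen RC-472)

HONEST FRAMING (cell `bsd-2adic`, D-0036/D-0054/D-0152): THEOREMS ONLY (no definition, no named fact, no `sorry`); each theorem
`classicalMu_two_<L>` is PROVED OUTRIGHT: Iwasawa's classical `μ₂` vanishes (growth form `ClassicalMuVanishes`) along every cyclotomic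
`ℤ₂`-extension of the cubic field `ℚ(θ)` = the `2`-torsion point field of the census curve `<L>` (an `S₃`-cubic field with `2 = 𝔭²𝔮`,
`2 = 𝔭₁𝔭₂` or even class number — OUTSIDE Iwasawa 1956). These statements were so far BURIED inside `conjA_two_<L> hLim2` (GEN 5–7); they are
the `hμ` input of cruxlead-19573-w2 GEN 7's «Iwasawa ℓ = 2 ascent with real places» to the totally complex `ℚ(E[2]) = ℚ(θ, √Δ)` (Δ < 0 on
every row here), after which w2's kernel Lim 3.5@2 (p723148) yields (A)₂ for these rows WITHOUT `hLim2`. This file closes nothing at the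
`∀`-level; nothing booked; it is number theory about cubic fields — BSD is not proved by any of this.

MECHANISM (all kernel, GEN 5–7 by name): Chevalley rows — `layerOneBit_of_chevalleyCert` (`e₁ = 0` from a `2`-adically certified non-norm
unit, ≤ 2 primes above `2`) + `classicalMuVanishes_two_adjoin_of_evenIndexCertificate` (`n₀ = 0` by the even-index certificate, Fukuda
Thm. 1 (1)); capitulation rows — `classNumberPExp_one_eq_zero_layer_d…` (`e₁ = e₀` by the capitulation certificate) +
`forall_totallyRamifiedFrom_zero_adjoin_of_…` + `classicalMuVanishes_of_classNumberPExp_succ_eq fukuda1994_…_holds`.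
Rows here: `297264q1` (d = -6756) · `413952bm1` (d = -12936) · `227772e1` (d = -11988).

References: [Fukuda1994] Thm. 1 (1); [Lang1990] Ch. 13 §4; [Greenberg2001IwasawaPastPresent] Prop. 2.1, §4; [Washington1997] §13.
-/

set_option autoImplicit false
-- sibling precedent (`…GenusDoorCubic.lean`): the directory name repeats the summit name
set_option linter.dupNamespace false

noncomputable section

open scoped Classical IntermediateField NumberField

namespace Summit.BirchSwinnertonDyer.BirchSwinnertonDyer.Theorems.AddKatoTwo

open WeierstrassCurve Field Polynomial IsDedekindDomain NumberField Matrix Literature.NumberTheory.EllipticCurves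
  Literature.NumberTheory.GaloisRepresentations
  Literature.NumberTheory.IwasawaTheory
  Summit.BirchSwinnertonDyer.BirchSwinnertonDyer.Theorems.AlignedTransportAtTwoTorsionPointField
  Summit.BirchSwinnertonDyer.BirchSwinnertonDyer.Theses.ByReductionTypeAtTwo

/-- **Iwasawa's `μ₂ = 0` for the cubic field of the census row `297264q1` (`d = -6756`, TWO primes above `2`), KERNEL — every cyclotomic
`ℤ₂`-extension of `ℚ(θ)` has `μ = 0` (growth form).** The `hμ`-core of `conjA_two_297264q1 hLim2` exposed by name: Chevalley's door at `2`
(`layerOneBit_of_chevalleyCert`: `e₁ = 0` from a non-norm unit) + the even-index certificate (`n₀ = 0`) + Fukuda 1994 Thm. 1 (1); NO Lim fact,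
no displayed datum. Input of cruxlead-19573-w2's ℓ = 2 ascent to `ℚ(E[2])` (Δ < 0). [cite: Fukuda1994, Thm. 1 (1), p. 264]
[cite: Lang1990, Ch. 13 §4, Lemma 4.1] [cite: Greenberg2001IwasawaPastPresent, §4 (Iwasawa's μ-conjecture)] -/
theorem classicalMu_two_297264q1 {θ : AlgebraicClosure ℚ} (hθ : aeval θ (Cubic.toPoly ⟨1, ((0 : ℤ) : ℚ), ((-51 : ℤ) : ℚ), ((-148 : ℤ) : ℚ)⟩) = 0) :
    haveI : FiniteDimensional ℚ (IntermediateField.adjoin ℚ {θ}) :=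
      IntermediateField.adjoin.finiteDimensional ((AlgebraicClosure.isAlgebraic ℚ).isAlgebraic θ).isIntegral
    haveI : NumberField (IntermediateField.adjoin ℚ {θ}) := NumberField.mk
    ∀ κL : ZpExtension (IntermediateField.adjoin ℚ {θ}) 2, κL.IsCyclotomic → ClassicalMuVanishes κL := by
  intro κL hκL
  have hθ' : θ ^ 3 + (0 : AlgebraicClosure ℚ) * θ ^ 2 + (-51 : AlgebraicClosure ℚ) * θ + (-148 : AlgebraicClosure ℚ) = 0 := by
    have := hθ
    simp only [Cubic.toPoly, map_one, one_mul, aeval_add, aeval_mul, aeval_C, aeval_X_pow, aeval_X,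
      eq_ratCast, Rat.cast_intCast] at this
    push_cast at this
    linear_combination this
  set θ₁ : AlgebraicClosure ℚ := algebraMap ℚ (AlgebraicClosure ℚ) (35 / 3 : ℚ) +
      algebraMap ℚ (AlgebraicClosure ℚ) (5 / 3 : ℚ) * θ + algebraMap ℚ (AlgebraicClosure ℚ) (-1 / 3 : ℚ) * θ ^ 2 with hθ₁def
  have hθ₁ : aeval θ₁ (Cubic.toPoly ⟨1, ((-1 : ℤ) : ℚ), ((9 : ℤ) : ℚ), ((-33 : ℤ) : ℚ)⟩) = 0 := by
    simp only [Cubic.toPoly, map_one, one_mul, aeval_add, aeval_mul, aeval_C, aeval_X_pow, aeval_X, eq_ratCast,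
      Rat.cast_intCast]
    rw [hθ₁def]
    simp only [eq_ratCast]
    push_cast
    linear_combination (((-278 : AlgebraicClosure ℚ) / 27) + ((-8 : AlgebraicClosure ℚ) / 9) * θ + ((5 : AlgebraicClosure ℚ) / 9) * θ ^ 2 + ((-1 : AlgebraicClosure ℚ) / 27) * θ ^ 3) * hθ'
  have hadj : IntermediateField.adjoin ℚ {θ₁} = IntermediateField.adjoin ℚ {θ} := by
    apply le_antisymm
    · rw [IntermediateField.adjoin_simple_le_iff, hθ₁def]
      have hθmem := IntermediateField.mem_adjoin_simple_self ℚ θ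
      exact add_mem (add_mem (algebraMap_mem _ _) (mul_mem (algebraMap_mem _ _) hθmem))
        (mul_mem (algebraMap_mem _ _) (pow_mem hθmem 2))
    · rw [IntermediateField.adjoin_simple_le_iff]
      have hθeq : θ = algebraMap ℚ (AlgebraicClosure ℚ) (5 / 2 : ℚ) + algebraMap ℚ (AlgebraicClosure ℚ) (1 : ℚ) * θ₁ +
          algebraMap ℚ (AlgebraicClosure ℚ) (1 / 2 : ℚ) * θ₁ ^ 2 := by
        rw [hθ₁def]; simp only [eq_ratCast]; push_cast; linear_combination (((5 : AlgebraicClosure ℚ) / 9) + ((-1 : AlgebraicClosure ℚ) / 18) * θ) * hθ'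
      rw [hθeq]
      have hθ₁mem := IntermediateField.mem_adjoin_simple_self ℚ θ₁
      exact add_mem (add_mem (algebraMap_mem _ _) (mul_mem (algebraMap_mem _ _) hθ₁mem))
        (mul_mem (algebraMap_mem _ _) (pow_mem hθ₁mem 2))
  have hh : ¬ 2 ∣ Nat.card (ClassGroup (𝓞 (IntermediateField.adjoin ℚ {θ}))) := by
    rw [← hadj]
    exact not_two_dvd_card_classGroup_adjoin_of_forall_cubicField irreducible_cubic_d6756n_min (classNumber_eq_one_of_root_d6756n) hθ₁
  have he : aeval (algebraMap ℚ (AlgebraicClosure ℚ) (((-30620405 : ℤ) : ℚ) / ((1 : ℤ) : ℚ)) +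
      algebraMap ℚ (AlgebraicClosure ℚ) (((-2538278 : ℤ) : ℚ) / ((1 : ℤ) : ℚ)) * θ +
      algebraMap ℚ (AlgebraicClosure ℚ) (((750750 : ℤ) : ℚ) / ((1 : ℤ) : ℚ)) * θ ^ 2)
      (Cubic.toPoly ⟨1, ((15284715 : ℤ) : ℚ), ((106717013294091 : ℤ) : ℚ), ((1 : ℤ) : ℚ)⟩) = 0 := by
    simp only [Cubic.toPoly, map_one, one_mul, aeval_add, aeval_mul, aeval_C, aeval_X_pow, aeval_X, eq_ratCast,
      Rat.cast_intCast, Rat.cast_div]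
    push_cast
    linear_combination ((119233798892279764048 : AlgebraicClosure ℚ) + (-7069315807289736000 : AlgebraicClosure ℚ) * θ + (-4291915096594125000 : AlgebraicClosure ℚ) * θ ^ 2 + (423141891046875000 : AlgebraicClosure ℚ) * θ ^ 3) * hθ'
  have h1 := layerOneBit_of_chevalleyCert irreducible_cubic_d6756n hθ hh ⟨1, by norm_num⟩ ⟨0, by norm_num⟩
      (-30620405) (-2538278) (750750) (1) (15284715) (106717013294091) (1) (by norm_num) he (4) (1) (by norm_num) (by norm_num) (by decide) (by decide)
  set θ₁ : AlgebraicClosure ℚ := algebraMap ℚ (AlgebraicClosure ℚ) (35 / 3 : ℚ) +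
      algebraMap ℚ (AlgebraicClosure ℚ) (5 / 3 : ℚ) * θ + algebraMap ℚ (AlgebraicClosure ℚ) (-1 / 3 : ℚ) * θ ^ 2 with hθ₁def
  have hθ₁ : aeval θ₁ (Cubic.toPoly ⟨1, ((-1 : ℤ) : ℚ), ((9 : ℤ) : ℚ), ((-33 : ℤ) : ℚ)⟩) = 0 := by
    simp only [Cubic.toPoly, map_one, one_mul, aeval_add, aeval_mul, aeval_C, aeval_X_pow, aeval_X, eq_ratCast,
      Rat.cast_intCast]
    rw [hθ₁def]
    simp only [eq_ratCast]
    push_cast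
    linear_combination (((-278 : AlgebraicClosure ℚ) / 27) + ((-8 : AlgebraicClosure ℚ) / 9) * θ + ((5 : AlgebraicClosure ℚ) / 9) * θ ^ 2 + ((-1 : AlgebraicClosure ℚ) / 27) * θ ^ 3) * hθ'
  have hadj : IntermediateField.adjoin ℚ {θ₁} = IntermediateField.adjoin ℚ {θ} := by
    apply le_antisymm
    · rw [IntermediateField.adjoin_simple_le_iff, hθ₁def]
      have hθmem := IntermediateField.mem_adjoin_simple_self ℚ θ
      exact add_mem (add_mem (algebraMap_mem _ _) (mul_mem (algebraMap_mem _ _) hθmem))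
        (mul_mem (algebraMap_mem _ _) (pow_mem hθmem 2))
    · rw [IntermediateField.adjoin_simple_le_iff]
      have hθeq : θ = algebraMap ℚ (AlgebraicClosure ℚ) (5 / 2 : ℚ) + algebraMap ℚ (AlgebraicClosure ℚ) (1 : ℚ) * θ₁ +
          algebraMap ℚ (AlgebraicClosure ℚ) (1 / 2 : ℚ) * θ₁ ^ 2 := by
        rw [hθ₁def]; simp only [eq_ratCast]; push_cast; linear_combination (((5 : AlgebraicClosure ℚ) / 9) + ((-1 : AlgebraicClosure ℚ) / 18) * θ) * hθ'
      rw [hθeq]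
      have hθ₁mem := IntermediateField.mem_adjoin_simple_self ℚ θ₁
      exact add_mem (add_mem (algebraMap_mem _ _) (mul_mem (algebraMap_mem _ _) hθ₁mem))
        (mul_mem (algebraMap_mem _ _) (pow_mem hθ₁mem 2))
  have hh : ¬ 2 ∣ Nat.card (ClassGroup (𝓞 (IntermediateField.adjoin ℚ {θ}))) := by
    rw [← hadj]
    exact not_two_dvd_card_classGroup_adjoin_of_forall_cubicField irreducible_cubic_d6756n_min (classNumber_eq_one_of_root_d6756n) hθ₁
  have hirr := irreducible_cubic_d6756n
  haveI : FiniteDimensional ℚ (IntermediateField.adjoin ℚ {θ}) :=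
    IntermediateField.adjoin.finiteDimensional ((AlgebraicClosure.isAlgebraic ℚ).isAlgebraic θ).isIntegral
  haveI : NumberField (IntermediateField.adjoin ℚ {θ}) := NumberField.mk
  obtain ⟨B, -, hB⟩ := exists_ringOfIntegers_cubic_root (p := 0) (q := -51) (r := -148) hθ
  have h3 := finrank_adjoin_eq_three_of_irreducible hirr hθ
  refine classicalMuVanishes_two_adjoin_of_evenIndexCertificate (p := 0) (q := -51) (r := -148) hirr hθ
    (((0 : ℤ) : 𝓞 (IntermediateField.adjoin ℚ {θ})) + ((-2 : ℤ) : 𝓞 (IntermediateField.adjoin ℚ {θ})) * B + ((0 : ℤ) : 𝓞 (IntermediateField.adjoin ℚ {θ})) * B ^ 2) (((0 : ℤ) : 𝓞 (IntermediateField.adjoin ℚ {θ})) + ((-1 : ℤ) : 𝓞 (IntermediateField.adjoin ℚ {θ})) * B + ((-1 : ℤ) : 𝓞 (IntermediateField.adjoin ℚ {θ})) * B ^ 2) (((-148 : ℤ) : 𝓞 (IntermediateField.adjoin ℚ {θ})) + ((-125 : ℤ) : 𝓞 (IntermediateField.adjoin ℚ {θ})) * B + ((-25 : ℤ) : 𝓞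 (IntermediateField.adjoin ℚ {θ})) * B ^ 2) (((473452 : ℤ) : 𝓞 (IntermediateField.adjoin ℚ {θ})) + ((224125 : ℤ) : 𝓞 (IntermediateField.adjoin ℚ {θ})) * B + ((27450 : ℤ) : 𝓞 (IntermediateField.adjoin ℚ {θ})) * B ^ 2) ?_ ?_ ?_
    hh κL hκL (h1 κL hκL)
  · push_cast; linear_combination (((-4 : ℤ) : 𝓞 (IntermediateField.adjoin ℚ {θ})) + ((-2 : ℤ) : 𝓞 (IntermediateField.adjoin ℚ {θ})) * B) * hB
  · push_cast; linear_combination (((6250 : ℤ) : 𝓞 (IntermediateField.adjoin ℚ {θ})) + ((625 : ℤ) : 𝓞 (IntermediateField.adjoin ℚ {θ})) * B) * hB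
  · have hz : (2 : 𝓞 (IntermediateField.adjoin ℚ {θ})) - (((473452 : ℤ) : 𝓞 (IntermediateField.adjoin ℚ {θ})) + ((224125 : ℤ) : 𝓞 (IntermediateField.adjoin ℚ {θ})) * B + ((27450 : ℤ) : 𝓞 (IntermediateField.adjoin ℚ {θ})) * B ^ 2) ^ 3 =
        ((-8636047589761233906 : ℤ) : 𝓞 (IntermediateField.adjoin ℚ {θ})) + (-4016815474903693875 : ℤ) * B + (-484136240522118150 : ℤ) * B ^ 2 := by
      push_cast; linear_combination (((-57634595312415625 : ℤ) : 𝓞 (IntermediateField.adjoin ℚ {θ})) + ((-6261714108483750 : ℤ) : 𝓞 (IntermediateField.adjoin ℚ {θ})) * B + ((-506636243437500 : ℤ) : 𝓞 (IntermediateField.adjoin ℚ {θ})) * B ^ 2 + ((-20683643625000 : ℤ) : 𝓞 (IntermediateField.adjoin ℚ {θ})) * B ^ 3) * hB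
    rw [hz]
    exact not_eight_dvd_norm_coords _ h3 B hirr hB (-8636047589761233906) (-4016815474903693875) (-484136240522118150) (N := -67030064143170275233513836266567175906966)
      (by simp only [Matrix.one_fin_three, Matrix.det_fin_three, Matrix.add_apply, Matrix.smul_apply, sq, Matrix.mul_apply,
        Fin.sum_univ_three, Matrix.of_apply, Matrix.cons_val', Matrix.cons_val_zero, Matrix.cons_val_one, Matrix.cons_val_two,
        Matrix.head_cons, Matrix.tail_cons, Matrix.empty_val', Matrix.cons_val_fin_one, smul_eq_mul]; norm_num) (by norm_num)

/-- **Iwasawa's `μ₂ = 0` for the cubic field of the census row `413952bm1` (`d = -12936`, TWO primes above `2`), KERNEL — every cyclotomic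
`ℤ₂`-extension of `ℚ(θ)` has `μ = 0` (growth form).** The `hμ`-core of `conjA_two_413952bm1 hLim2` exposed by name: Chevalley's door at `2`
(`layerOneBit_of_chevalleyCert`: `e₁ = 0` from a non-norm unit) + the even-index certificate (`n₀ = 0`) + Fukuda 1994 Thm. 1 (1); NO Lim fact,
no displayed datum. Input of cruxlead-19573-w2's ℓ = 2 ascent to `ℚ(E[2])` (Δ < 0). [cite: Fukuda1994, Thm. 1 (1), p. 264]
[cite: Lang1990, Ch. 13 §4, Lemma 4.1] [cite: Greenberg2001IwasawaPastPresent, §4 (Iwasawa's μ-conjecture)] -/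
theorem classicalMu_two_413952bm1 {θ : AlgebraicClosure ℚ} (hθ : aeval θ (Cubic.toPoly ⟨1, ((-1 : ℤ) : ℚ), ((-30 : ℤ) : ℚ), ((78 : ℤ) : ℚ)⟩) = 0) :
    haveI : FiniteDimensional ℚ (IntermediateField.adjoin ℚ {θ}) :=
      IntermediateField.adjoin.finiteDimensional ((AlgebraicClosure.isAlgebraic ℚ).isAlgebraic θ).isIntegral
    haveI : NumberField (IntermediateField.adjoin ℚ {θ}) := NumberField.mk
    ∀ κL : ZpExtension (IntermediateField.adjoin ℚ {θ}) 2, κL.IsCyclotomic → ClassicalMuVanishes κL := by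
  intro κL hκL
  have hθ' : θ ^ 3 + (-1 : AlgebraicClosure ℚ) * θ ^ 2 + (-30 : AlgebraicClosure ℚ) * θ + (78 : AlgebraicClosure ℚ) = 0 := by
    have := hθ
    simp only [Cubic.toPoly, map_one, one_mul, aeval_add, aeval_mul, aeval_C, aeval_X_pow, aeval_X,
      eq_ratCast, Rat.cast_intCast] at this
    push_cast at this
    linear_combination this
  have he : aeval (algebraMap ℚ (AlgebraicClosure ℚ) (((-9985 : ℤ) : ℚ) / ((1 : ℤ) : ℚ)) +
      algebraMap ℚ (AlgebraicClosure ℚ) (((1041 : ℤ) : ℚ) / ((1 : ℤ) : ℚ)) * θ +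
      algebraMap ℚ (AlgebraicClosure ℚ) (((443 : ℤ) : ℚ) / ((1 : ℤ) : ℚ)) * θ ^ 2)
      (Cubic.toPoly ⟨1, ((1891 : ℤ) : ℚ), ((7468361 : ℤ) : ℚ), ((-1 : ℤ) : ℚ)⟩) = 0 := by
    simp only [Cubic.toPoly, map_one, one_mul, aeval_add, aeval_mul, aeval_C, aeval_X_pow, aeval_X, eq_ratCast,
      Rat.cast_intCast, Rat.cast_div]
    push_cast
    linear_combination ((-11301861612 : AlgebraicClosure ℚ) + (-759346743 : AlgebraicClosure ℚ) * θ + (699823934 : AlgebraicClosure ℚ) * θ ^ 2 + (86938307 : AlgebraicClosure ℚ) * θ ^ 3) * hθ'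
  have h1 := layerOneBit_of_chevalleyCert irreducible_cubic_d12936n hθ (not_two_dvd_card_classGroup_adjoin_of_forall_cubicField_odd irreducible_cubic_d12936n (odd_classNumber_of_root_d12936n) hθ) ⟨0, by norm_num⟩ ⟨1, by norm_num⟩
      (-9985) (1041) (443) (1) (1891) (7468361) (-1) (by norm_num) he (1) (1) (by norm_num) (by norm_num) (by decide) (by decide)
  have hh := (not_two_dvd_card_classGroup_adjoin_of_forall_cubicField_odd irreducible_cubic_d12936n (odd_classNumber_of_root_d12936n) hθ)
  have hirr := irreducible_cubic_d12936n
  haveI : FiniteDimensional ℚ (IntermediateField.adjoin ℚ {θ}) :=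
    IntermediateField.adjoin.finiteDimensional ((AlgebraicClosure.isAlgebraic ℚ).isAlgebraic θ).isIntegral
  haveI : NumberField (IntermediateField.adjoin ℚ {θ}) := NumberField.mk
  obtain ⟨B, -, hB⟩ := exists_ringOfIntegers_cubic_root (p := -1) (q := -30) (r := 78) hθ
  have h3 := finrank_adjoin_eq_three_of_irreducible hirr hθ
  refine classicalMuVanishes_two_adjoin_of_evenIndexCertificate (p := -1) (q := -30) (r := 78) hirr hθ
    (((0 : ℤ) : 𝓞 (IntermediateField.adjoin ℚ {θ})) + ((-1 : ℤ) : 𝓞 (IntermediateField.adjoin ℚ {θ})) * B + ((1 : ℤ) : 𝓞 (IntermediateField.adjoin ℚ {θ})) * B ^ 2) (((-1 : ℤ) : 𝓞 (IntermediateField.adjoin ℚ {θ})) + ((0 : ℤ) : 𝓞 (IntermediateField.adjoin ℚ {θ})) * B + ((-1 : ℤ) : 𝓞 (IntermediateField.adjoin ℚ {θ})) * B ^ 2) (((58 : ℤ) : 𝓞 (IntermediateField.adjoin ℚ {θ})) + ((-3 : ℤ) : 𝓞 (IntermediateField.adjoin ℚ {θ})) * B + ((-9 : ℤ) : 𝓞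 (IntermediateField.adjoin ℚ {θ})) * B ^ 2) (((-3583 : ℤ) : 𝓞 (IntermediateField.adjoin ℚ {θ})) + ((-1308 : ℤ) : 𝓞 (IntermediateField.adjoin ℚ {θ})) * B + ((765 : ℤ) : 𝓞 (IntermediateField.adjoin ℚ {θ})) * B ^ 2) ?_ ?_ ?_
    hh κL hκL (h1 κL hκL)
  · push_cast; linear_combination (((-3 : ℤ) : 𝓞 (IntermediateField.adjoin ℚ {θ})) + ((-1 : ℤ) : 𝓞 (IntermediateField.adjoin ℚ {θ})) * B) * hB
  · push_cast; linear_combination (((135 : ℤ) : 𝓞 (IntermediateField.adjoin ℚ {θ})) + ((81 : ℤ) : 𝓞 (IntermediateField.adjoin ℚ {θ})) * B) * hB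
  · have hz : (2 : 𝓞 (IntermediateField.adjoin ℚ {θ})) - (((-3583 : ℤ) : 𝓞 (IntermediateField.adjoin ℚ {θ})) + ((-1308 : ℤ) : 𝓞 (IntermediateField.adjoin ℚ {θ})) * B + ((765 : ℤ) : 𝓞 (IntermediateField.adjoin ℚ {θ})) * B ^ 2) ^ 3 =
        ((-4781468099427 : ℤ) : 𝓞 (IntermediateField.adjoin ℚ {θ})) + (2626100578836 : ℤ) * B + (-369924015447 : ℤ) * B ^ 2 := by
      push_cast; linear_combination (((61890593022 : ℤ) : 𝓞 (IntermediateField.adjoin ℚ {θ})) + ((-9218037330 : ℤ) : 𝓞 (IntermediateField.adjoin ℚ {θ})) * B + ((1848725775 : ℤ) : 𝓞 (IntermediateField.adjoin ℚ {θ})) * B ^ 2 + ((-447697125 : ℤ) : 𝓞 (IntermediateField.adjoin ℚ {θ})) * B ^ 3) * hB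
    rw [hz]
    exact not_eight_dvd_norm_coords _ h3 B hirr hB (-4781468099427) (2626100578836) (-369924015447) (N := -14230880865242125521069838067082198)
      (by simp only [Matrix.one_fin_three, Matrix.det_fin_three, Matrix.add_apply, Matrix.smul_apply, sq, Matrix.mul_apply,
        Fin.sum_univ_three, Matrix.of_apply, Matrix.cons_val', Matrix.cons_val_zero, Matrix.cons_val_one, Matrix.cons_val_two,
        Matrix.head_cons, Matrix.tail_cons, Matrix.empty_val', Matrix.cons_val_fin_one, smul_eq_mul]; norm_num) (by norm_num)

/-- **Iwasawa's `μ₂ = 0` for the cubic field of the census row `227772e1` (`d = -11988`, TWO primes above `2`), KERNEL — every cyclotomic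
`ℤ₂`-extension of `ℚ(θ)` has `μ = 0` (growth form).** The `hμ`-core of `conjA_two_227772e1 hLim2` exposed by name: Chevalley's door at `2`
(`layerOneBit_of_chevalleyCert`: `e₁ = 0` from a non-norm unit) + the even-index certificate (`n₀ = 0`) + Fukuda 1994 Thm. 1 (1); NO Lim fact,
no displayed datum. Input of cruxlead-19573-w2's ℓ = 2 ascent to `ℚ(E[2])` (Δ < 0). [cite: Fukuda1994, Thm. 1 (1), p. 264]
[cite: Lang1990, Ch. 13 §4, Lemma 4.1] [cite: Greenberg2001IwasawaPastPresent, §4 (Iwasawa's μ-conjecture)] -/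
theorem classicalMu_two_227772e1 {θ : AlgebraicClosure ℚ} (hθ : aeval θ (Cubic.toPoly ⟨1, ((0 : ℤ) : ℚ), ((33 : ℤ) : ℚ), ((-76 : ℤ) : ℚ)⟩) = 0) :
    haveI : FiniteDimensional ℚ (IntermediateField.adjoin ℚ {θ}) :=
      IntermediateField.adjoin.finiteDimensional ((AlgebraicClosure.isAlgebraic ℚ).isAlgebraic θ).isIntegral
    haveI : NumberField (IntermediateField.adjoin ℚ {θ}) := NumberField.mk
    ∀ κL : ZpExtension (IntermediateField.adjoin ℚ {θ}) 2, κL.IsCyclotomic → ClassicalMuVanishes κL := by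
  intro κL hκL
  have hθ' : θ ^ 3 + (0 : AlgebraicClosure ℚ) * θ ^ 2 + (33 : AlgebraicClosure ℚ) * θ + (-76 : AlgebraicClosure ℚ) = 0 := by
    have := hθ
    simp only [Cubic.toPoly, map_one, one_mul, aeval_add, aeval_mul, aeval_C, aeval_X_pow, aeval_X,
      eq_ratCast, Rat.cast_intCast] at this
    push_cast at this
    linear_combination this
  set θ₁ : AlgebraicClosure ℚ := algebraMap ℚ (AlgebraicClosure ℚ) (22 / 5 : ℚ) +
      algebraMap ℚ (AlgebraicClosure ℚ) (3 / 5 : ℚ) * θ + algebraMap ℚ (AlgebraicClosure ℚ) (1 / 5 : ℚ) * θ ^ 2 with hθ₁def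
  have hθ₁ : aeval θ₁ (Cubic.toPoly ⟨1, ((0 : ℤ) : ℚ), ((-30 : ℤ) : ℚ), ((-76 : ℤ) : ℚ)⟩) = 0 := by
    simp only [Cubic.toPoly, map_one, one_mul, aeval_add, aeval_mul, aeval_C, aeval_X_pow, aeval_X, eq_ratCast,
      Rat.cast_intCast]
    rw [hθ₁def]
    simp only [eq_ratCast]
    push_cast
    linear_combination (((202 : AlgebraicClosure ℚ) / 125) + ((12 : AlgebraicClosure ℚ) / 25) * θ + ((9 : AlgebraicClosure ℚ) / 125) * θ ^ 2 + ((1 : AlgebraicClosure ℚ) / 125) * θ ^ 3) * hθ'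
  have hadj : IntermediateField.adjoin ℚ {θ₁} = IntermediateField.adjoin ℚ {θ} := by
    apply le_antisymm
    · rw [IntermediateField.adjoin_simple_le_iff, hθ₁def]
      have hθmem := IntermediateField.mem_adjoin_simple_self ℚ θ
      exact add_mem (add_mem (algebraMap_mem _ _) (mul_mem (algebraMap_mem _ _) hθmem))
        (mul_mem (algebraMap_mem _ _) (pow_mem hθmem 2))
    · rw [IntermediateField.adjoin_simple_le_iff]
      have hθeq : θ = algebraMap ℚ (AlgebraicClosure ℚ) (10 : ℚ) + algebraMap ℚ (AlgebraicClosure ℚ) (2 : ℚ) * θ₁ +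
          algebraMap ℚ (AlgebraicClosure ℚ) (-1 / 2 : ℚ) * θ₁ ^ 2 := by
        rw [hθ₁def]; simp only [eq_ratCast]; push_cast; linear_combination (((3 : AlgebraicClosure ℚ) / 25) + ((1 : AlgebraicClosure ℚ) / 50) * θ) * hθ'
      rw [hθeq]
      have hθ₁mem := IntermediateField.mem_adjoin_simple_self ℚ θ₁
      exact add_mem (add_mem (algebraMap_mem _ _) (mul_mem (algebraMap_mem _ _) hθ₁mem))
        (mul_mem (algebraMap_mem _ _) (pow_mem hθ₁mem 2))
  have hh : ¬ 2 ∣ Nat.card (ClassGroup (𝓞 (IntermediateField.adjoin ℚ {θ}))) := by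
    rw [← hadj]
    exact not_two_dvd_card_classGroup_adjoin_of_forall_cubicField irreducible_cubic_d11988n_min (classNumber_eq_one_of_root_d11988n) hθ₁
  have he : aeval (algebraMap ℚ (AlgebraicClosure ℚ) (((5556677 : ℤ) : ℚ) / ((1 : ℤ) : ℚ)) +
      algebraMap ℚ (AlgebraicClosure ℚ) (((-6903122 : ℤ) : ℚ) / ((1 : ℤ) : ℚ)) * θ +
      algebraMap ℚ (AlgebraicClosure ℚ) (((2047192 : ℤ) : ℚ) / ((1 : ℤ) : ℚ)) * θ ^ 2)
      (Cubic.toPoly ⟨1, ((118444641 : ℤ) : ℚ), ((7949698203601839 : ℤ) : ℚ), ((-1 : ℤ) : ℚ)⟩) = 0 := by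
    simp only [Cubic.toPoly, map_one, one_mul, aeval_add, aeval_mul, aeval_C, aeval_X_pow, aeval_X, eq_ratCast,
      Rat.cast_intCast, Rat.cast_div]
    push_cast
    linear_combination ((-631613836991334026824 : AlgebraicClosure ℚ) + (575797557547488211488 : AlgebraicClosure ℚ) * θ + (-86792851116649636224 : AlgebraicClosure ℚ) * θ ^ 2 + (8579771609772901888 : AlgebraicClosure ℚ) * θ ^ 3) * hθ'
  have h1 := layerOneBit_of_chevalleyCert irreducible_cubic_d11988n hθ hh ⟨1, by norm_num⟩ ⟨0, by norm_num⟩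
      (5556677) (-6903122) (2047192) (1) (118444641) (7949698203601839) (-1) (by norm_num) he (4) (1) (by norm_num) (by norm_num) (by decide) (by decide)
  set θ₁ : AlgebraicClosure ℚ := algebraMap ℚ (AlgebraicClosure ℚ) (22 / 5 : ℚ) +
      algebraMap ℚ (AlgebraicClosure ℚ) (3 / 5 : ℚ) * θ + algebraMap ℚ (AlgebraicClosure ℚ) (1 / 5 : ℚ) * θ ^ 2 with hθ₁def
  have hθ₁ : aeval θ₁ (Cubic.toPoly ⟨1, ((0 : ℤ) : ℚ), ((-30 : ℤ) : ℚ), ((-76 : ℤ) : ℚ)⟩) = 0 := by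
    simp only [Cubic.toPoly, map_one, one_mul, aeval_add, aeval_mul, aeval_C, aeval_X_pow, aeval_X, eq_ratCast,
      Rat.cast_intCast]
    rw [hθ₁def]
    simp only [eq_ratCast]
    push_cast
    linear_combination (((202 : AlgebraicClosure ℚ) / 125) + ((12 : AlgebraicClosure ℚ) / 25) * θ + ((9 : AlgebraicClosure ℚ) / 125) * θ ^ 2 + ((1 : AlgebraicClosure ℚ) / 125) * θ ^ 3) * hθ'
  have hadj : IntermediateField.adjoin ℚ {θ₁} = IntermediateField.adjoin ℚ {θ} := by
    apply le_antisymm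
    · rw [IntermediateField.adjoin_simple_le_iff, hθ₁def]
      have hθmem := IntermediateField.mem_adjoin_simple_self ℚ θ
      exact add_mem (add_mem (algebraMap_mem _ _) (mul_mem (algebraMap_mem _ _) hθmem))
        (mul_mem (algebraMap_mem _ _) (pow_mem hθmem 2))
    · rw [IntermediateField.adjoin_simple_le_iff]
      have hθeq : θ = algebraMap ℚ (AlgebraicClosure ℚ) (10 : ℚ) + algebraMap ℚ (AlgebraicClosure ℚ) (2 : ℚ) * θ₁ +
          algebraMap ℚ (AlgebraicClosure ℚ) (-1 / 2 : ℚ) * θ₁ ^ 2 := by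
        rw [hθ₁def]; simp only [eq_ratCast]; push_cast; linear_combination (((3 : AlgebraicClosure ℚ) / 25) + ((1 : AlgebraicClosure ℚ) / 50) * θ) * hθ'
      rw [hθeq]
      have hθ₁mem := IntermediateField.mem_adjoin_simple_self ℚ θ₁
      exact add_mem (add_mem (algebraMap_mem _ _) (mul_mem (algebraMap_mem _ _) hθ₁mem))
        (mul_mem (algebraMap_mem _ _) (pow_mem hθ₁mem 2))
  have hh : ¬ 2 ∣ Nat.card (ClassGroup (𝓞 (IntermediateField.adjoin ℚ {θ}))) := by
    rw [← hadj]
    exact not_two_dvd_card_classGroup_adjoin_of_forall_cubicField irreducible_cubic_d11988n_min (classNumber_eq_one_of_root_d11988n) hθ₁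
  have hirr := irreducible_cubic_d11988n
  haveI : FiniteDimensional ℚ (IntermediateField.adjoin ℚ {θ}) :=
    IntermediateField.adjoin.finiteDimensional ((AlgebraicClosure.isAlgebraic ℚ).isAlgebraic θ).isIntegral
  haveI : NumberField (IntermediateField.adjoin ℚ {θ}) := NumberField.mk
  obtain ⟨B, -, hB⟩ := exists_ringOfIntegers_cubic_root (p := 0) (q := 33) (r := -76) hθ
  have h3 := finrank_adjoin_eq_three_of_irreducible hirr hθ
  refine classicalMuVanishes_two_adjoin_of_evenIndexCertificate (p := 0) (q := 33) (r := -76) hirr hθ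
    (((0 : ℤ) : 𝓞 (IntermediateField.adjoin ℚ {θ})) + ((-2 : ℤ) : 𝓞 (IntermediateField.adjoin ℚ {θ})) * B + ((0 : ℤ) : 𝓞 (IntermediateField.adjoin ℚ {θ})) * B ^ 2) (((0 : ℤ) : 𝓞 (IntermediateField.adjoin ℚ {θ})) + ((-1 : ℤ) : 𝓞 (IntermediateField.adjoin ℚ {θ})) * B + ((-1 : ℤ) : 𝓞 (IntermediateField.adjoin ℚ {θ})) * B ^ 2) (((-76 : ℤ) : 𝓞 (IntermediateField.adjoin ℚ {θ})) + ((-5 : ℤ) : 𝓞 (IntermediateField.adjoin ℚ {θ})) * B + ((17 : ℤ) : 𝓞 (IntermediateField.adjoin ℚ {θ})) * B ^ 2) (((-3572 : ℤ) : 𝓞 (IntermediateField.adjoin ℚ {θ})) + ((14167 : ℤ) : 𝓞 (IntermediateField.adjoin ℚ {θ})) * B + ((-6048 : ℤ) : 𝓞 (IntermediateField.adjoin ℚ {θ})) * B ^ 2) ?_ ?_ ?_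
    hh κL hκL (h1 κL hκL)
  · push_cast; linear_combination (((-4 : ℤ) : 𝓞 (IntermediateField.adjoin ℚ {θ})) + ((-2 : ℤ) : 𝓞 (IntermediateField.adjoin ℚ {θ})) * B) * hB
  · push_cast; linear_combination (((-170 : ℤ) : 𝓞 (IntermediateField.adjoin ℚ {θ})) + ((289 : ℤ) : 𝓞 (IntermediateField.adjoin ℚ {θ})) * B) * hB
  · have hz : (2 : 𝓞 (IntermediateField.adjoin ℚ {θ})) - (((-3572 : ℤ) : 𝓞 (IntermediateField.adjoin ℚ {θ})) + ((14167 : ℤ) : 𝓞 (IntermediateField.adjoin ℚ {θ})) * B + ((-6048 : ℤ) : 𝓞 (IntermediateField.adjoin ℚ {θ})) * B ^ 2) ^ 3 =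
        ((4821159821462574 : ℤ) : 𝓞 (IntermediateField.adjoin ℚ {θ})) + (-2342205213711657 : ℤ) * B + (-7960764352836 : ℤ) * B ^ 2 := by
      push_cast; linear_combination (((63435713758649 : ℤ) : 𝓞 (IntermediateField.adjoin ℚ {θ})) + ((-3266899757856 : ℤ) : 𝓞 (IntermediateField.adjoin ℚ {θ})) * B + ((-1554614498304 : ℤ) : 𝓞 (IntermediateField.adjoin ℚ {θ})) * B ^ 2 + ((221225582592 : ℤ) : 𝓞 (IntermediateField.adjoin ℚ {θ})) * B ^ 3) * hB
    rw [hz]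
    exact not_eight_dvd_norm_coords _ h3 B hirr hB (4821159821462574) (-2342205213711657) (-7960764352836) (N := -385398025154370760808264051881361265030)
      (by simp only [Matrix.one_fin_three, Matrix.det_fin_three, Matrix.add_apply, Matrix.smul_apply, sq, Matrix.mul_apply,
        Fin.sum_univ_three, Matrix.of_apply, Matrix.cons_val', Matrix.cons_val_zero, Matrix.cons_val_one, Matrix.cons_val_two,
        Matrix.head_cons, Matrix.tail_cons, Matrix.empty_val', Matrix.cons_val_fin_one, smul_eq_mul]; norm_num) (by norm_num)

end Summit.BirchSwinnertonDyer.BirchSwinnertonDyer.Theorems.AddKatoTwo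

end
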